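import Literature.AlgebraicGeometry.Resolution.AlterationsFunctionField
import Literature.AlgebraicGeometry.Resolution.StrictNormalCrossings
import Mathlib.FieldTheory.Perfect
import Mathlib.FieldTheory.Separable
import Mathlib.Data.Nat.Factors
import HarnessLib

/-!
# Alterations of controlled degree with regular source: Gabber's prime-to-`ℓ` alteration theorem
# (Illusie–Laszlo–Orgogozo 2014, Exp. X, Thm. 2.1) and Temkin's `char(X)`-alteration theorem
# (Temkin 2017, Thm. 1.2.5) — named facts

Topic `Literature/AlgebraicGeometry/Resolution`; companion of `Alterations.lean` (`IsAlteration`,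
`DeJong1996`, the open `AbramovichOortConjecture`), `AlterationsStrong.lean` (`DeJong1996Strong`,
`DeJong1996StrongPerfect` = de Jong 1996, Thm. 4.1 in full) and `AlterationsFunctionField.lean`
(`[K(X') : K(X)] < ∞` for an alteration). The two refinements of de Jong's theorem that CONTROL THE
DEGREE `[K(X') : K(X)]` of the regular alteration are vendored here as NAMED FACTS (D-0014), in the
tree's vocabulary, for the literature layer of the `ResolutionOfSingularities` campaign (D-0089,
rungs LIT-3): de Jong gives no degree control (only: `φ` generically étale, i.e. `K(X')/K(X)`
separable, when `k` is perfect); Gabber gives, for ONE chosen prime `ℓ` invertible on `X`, a regular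
alteration of degree prime to `ℓ`; Temkin gives a regular alteration whose degree has all its prime
factors among the residue characteristics of `X` — for a variety over a field of characteristic
`p > 0` a power of `p`, over a field of characteristic `0` degree `1` — separable when `k` is
perfect. (A regular alteration with `K(X')/K(X)` PURELY INSEPARABLE is the open
`AbramovichOortConjecture`; none of the theorems here asserts it.)

## Sources, verbatim (texts in hand, read 2026-08-26)

* L. Illusie, Y. Laszlo, F. Orgogozo (eds.), *Travaux de Gabber sur l'uniformisation locale et la
  cohomologie étale des schémas quasi-excellents. Séminaire à l'École polytechnique 2006–2008*,
  Astérisque 363–364 (2014); page numbers below are those of arXiv:1207.3648v1. **Exp. X**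
  (L. Illusie, M. Temkin, *Gabber's modification theorem (log smooth case)*), **§2, p. 148**: "Let
  `X` be a noetherian scheme, and `ℓ` be a prime number. A morphism `h : X' → X` is called an
  `ℓ'`-alteration if `h` is proper, surjective, generically finite, maximally dominating (i.e.,
  (II-1.1.2) sends each maximal point to a maximal point) and the degrees of the residual extensions
  `k(x')/k(x)` over each maximal point `x` of `X` are prime to `ℓ`. The next theorem was stated in
  (Introduction 0.3 (1))". **Exp. X, Theorem 2.1 (Gabber), p. 149**: "Let `k` be a field, `ℓ` a
  prime number different from the characteristic of `k`, `X` a separated and finite type `k`-scheme,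
  `Z ⊂ X` a nowhere dense closed subset. Then there exists a finite extension `k'` of `k`, of degree
  prime to `ℓ`, and a projective `ℓ'`-alteration `h : X̃ → X` above `Spec k' → Spec k`, with `X̃`
  smooth and quasi-projective over `k'`, and `h⁻¹(Z)` is the support of a relative, strict normal
  crossings divisor." (= Exp. 0, Théorème 3 (1), p. 3.) **Exp. X, 3.3.1, p. 158**: "Recall that `f`
  is an `ℓ'`-alteration if `([k(x) : k(f(x))], ℓ) = 1` for any `x ∈ η'`. We say that `f` is
  separable if `k(η')` is a separable `k(η)`-algebra".
* M. Temkin, *Tame distillation and desingularization by `p`-alterations*, Ann. of Math. 186 (2017)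
  97–126; numbering and pages of arXiv:1508.06255v2. **§1.1.1, p. 1**: "an alteration
  `b : X' → X`, i.e. a proper dominant generically finite morphism between integral schemes".
  **§1.1.2, p. 1** (on Gabber): "it is proved in [IT14b, Theorems 2.1 and 2.4] that if `ℓ` is a
  prime invertible on `X` then one can achieve that the degree `[k(X') : k(X)]` of the alteration
  `b` is not divisible by `ℓ`". **§1.2.1, p. 2**: "Given a scheme `X`, by `char(X)` we denote the
  set of all primes `p` with `p = char(k(x))` for some `x ∈ X`. Let `𝒫` be a set of primes. We say
  that `n ∈ ℕ` is a `𝒫`-number if all its prime divisors lie in `𝒫`. By a `𝒫`-alteration we mean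
  an alteration whose degree is a `𝒫`-number." **§1.2.4, p. 2**: "the general case is not
  essentially stronger than the case of integral `X` and `S`, in which it suffices to consider
  alterations as defined earlier." **Theorem 1.2.5, pp. 2–3**: "Let `X` be a scheme with a nowhere
  dense closed subset `Z` and assume that `X` admits a morphism of finite type to a qe scheme `S`
  with `dim(S) ≤ 3`. Then there exists a projective `char(X)`-alteration `b : X' → X` with a regular
  source such that `Z' = b⁻¹(Z)` is an snc divisor. Moreover, if `S = Spec(k)`, where `k` is a
  perfect field, then the alteration `b` can be chosen separable." **Remark 1.2.6 (i)**: "This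
  result is based on [CP14]" (Cossart–Piltant, resolution of quasi-excellent threefolds; for
  `S = Spec k` only `dim S = 0` is used).

## Rendering (integral special case `S = Spec k`, in the vocabulary of `Alterations.lean`)

* Input (both facts): a field `k`, an INTEGRAL SEPARATED `k`-scheme `X` OF FINITE TYPE
  (`IsSeparated`, `LocallyOfFiniteType`, `QuasiCompact` of `X → Spec k`; de Jong 1996, 2.9), and a
  closed `Z ≠ X` (for irreducible `X`, "nowhere dense closed" ⟺ "closed and `≠ X`"). Gabber's
  theorem moreover takes a prime `ℓ` with `(ℓ : k) ≠ 0` ("different from the characteristic").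
* Output: a scheme `X₁`, a morphism `φ : X₁ ⟶ X` which is an alteration in de Jong's sense
  (`IsAlteration`: `X₁` integral, `φ` proper dominant, finite over a non-empty open), `X₁` REGULAR
  (`Scheme.IsRegular`), the preimage `φ⁻¹(Z)` (the support of) a strict normal crossings divisor of
  `X₁` (`IsStrictNormalCrossingsDivisor`, de Jong 1996, 2.4 — vacuous for `Z = ∅`), and the DEGREE
  `IsAlteration.degree φ = [K(X₁) : K(X)]` (`Module.finrank` of `Motives.FunctionFieldOver φ`, finite
  by `IsAlteration.finiteDimensional_functionFieldOver`) controlled: `¬ ℓ ∣ deg φ` (Gabber), resp.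
  every prime `q ∣ deg φ` satisfies `(q : k) = 0`, i.e. `q = char k` (Temkin: "all prime divisors
  lie in `char(X)`"; every residue field of a `k`-scheme has the characteristic of `k`, so
  `char(X) = {char k} ∖ {0}`); and, for Temkin over PERFECT `k`, `φ` separable: `K(X₁)/K(X)`
  separable (`IsAlteration.IsSeparable`, Exp. X 3.3.1; ⟺ generically étale, de Jong 1996, 2.20).
* From print to the rendering: the printed sources of `h`/`b` need not be connected; for integral
  `X` one keeps the connected (= irreducible, the source being regular) component through a point
  over the generic point of `X` — it is proper, dominant and generically finite over `X`, i.e. an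
  alteration of integral schemes, of degree `[k(x') : k(η_X)]` prime to `ℓ` (Gabber), resp. a
  `char(X)`-number (Temkin, who states the integral reading himself, §§1.1.2, 1.2.4); smooth over
  `k'` ⟹ regular; a relative snc divisor in a smooth `k'`-scheme is an snc divisor (de Jong 2.4).
* WEAKER than print, deliberately (what is dropped): projectivity of `h`, `b`; quasi-projectivity
  and SMOOTHNESS of `X̃` over the prime-to-`ℓ` extension `k'` (only regularity is kept); the
  relative (over `k'`) form of the snc condition; Temkin's generality (any `X` of finite type over a
  quasi-excellent `S` of dimension `≤ 3`, non-integral `X`) and Gabber's second theorem over an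
  excellent Dedekind base (Exp. X, Thm. 2.4 = Exp. 0, Thm. 3 (2)). TODO(general form): `X` of finite
  type over a quasi-excellent base of dimension `≤ 3`; `ℓ'`-alterations of non-integral schemes.

## What is NOT here

No proofs of the two theorems (Gabber: Exp. VIII–X, ≈ 130 pp.; Temkin: tame distillation); Gabber's
prime-to-`ℓ` LOCAL UNIFORMIZATION of quasi-excellent schemes (Exp. 0 Thm. 2 / Exp. IX Thm. 1.1 — a
finite `ℓ'`-hypercovering by regular schemes, not one alteration); de Jong's theorems themselves
(`DeJong1996*`, `DeJong1997_galoisAlteration`, already in the tree); the purely inseparable case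
(`AbramovichOortConjecture`, OPEN).

## References

* [IllusieLaszloOrgogozo2014] Astérisque 363–364 (2014), Exp. 0 Thm. 3 (1) (p. 3), Exp. X §2 and
  Thm. 2.1 (pp. 148–149), Exp. X 3.3.1 (p. 158) — arXiv:1207.3648v1 pagination.
* [Temkin2017] Ann. of Math. 186 (2017), §§1.1.1, 1.1.2, 1.2.1, 1.2.4, Thm. 1.2.5, Rem. 1.2.6 —
  arXiv:1508.06255v2 numbering, pp. 1–3.
* [DeJong1996] Publ. Math. IHÉS 83 (1996), 2.4 (snc), 2.9 (variety), 2.20 (alteration; generically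
  étale ⟺ `K(X) ⊂ K(X')` separable), Thm. 4.1 (p. 66).
-/

noncomputable section

open CategoryTheory AlgebraicGeometry TopologicalSpace

namespace Literature.AlgebraicGeometry.Resolution

universe u

open Literature.AlgebraicGeometry.Motives Literature.AlgebraicGeometry.Motives.RatFn

/-! ## The degree of an alteration and separable alterations -/

namespace IsAlteration

variable {X₁ X : Scheme.{u}} [IsIntegral X] {φ : X₁ ⟶ X}

/-- **Degree of an alteration** `φ : X₁ → X` onto an integral scheme: `deg φ = [K(X₁) : K(X)]`, the
degree of the (finite, `IsAlteration.finiteDimensional_functionFieldOver`) extension of function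
fields along the dominant `φ` (Temkin 2017, §1.1.2: "the degree `[k(X') : k(X)]` of the alteration";
de Jong 1996, 2.20). [cite: Temkin2017, §1.1.2 and §1.2.1 (arXiv:1508.06255v2 p. 2)] -/
def degree (h : IsAlteration φ) : ℕ :=
  haveI : IsIntegral X₁ := h.isIntegral
  haveI : IsDominant φ := h.isDominant
  Module.finrank X.functionField (FunctionFieldOver φ)

/-- **Separable alteration** (Illusie–Laszlo–Orgogozo 2014, Exp. X, 3.3.1: "`f` is separable if
`k(η')` is a separable `k(η)`-algebra"; for integral schemes: `K(X₁)/K(X)` is separable — by de Jong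
1996, 2.20, equivalently `φ` is generically étale).
[cite: IllusieLaszloOrgogozo2014, Exp. X 3.3.1 (arXiv:1207.3648v1 p. 158)] -/
def IsSeparable (h : IsAlteration φ) : Prop :=
  haveI : IsIntegral X₁ := h.isIntegral
  haveI : IsDominant φ := h.isDominant
  Algebra.IsSeparable X.functionField (FunctionFieldOver φ)

/-- Unfolding the degree when the instances are around (the definition, Temkin 2017, §1.1.2:
`deg φ = [k(X') : k(X)]`). [cite: Temkin2017, §1.1.2 (arXiv:1508.06255v2 p. 1)] -/
theorem degree_eq_finrank [IsIntegral X₁] [IsDominant φ] (h : IsAlteration φ) :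
    h.degree = Module.finrank X.functionField (FunctionFieldOver φ) := rfl

/-- Unfolding separability when the instances are around (the definition, Exp. X 3.3.1).
[cite: IllusieLaszloOrgogozo2014, Exp. X 3.3.1 (arXiv:1207.3648v1 p. 158)] -/
theorem isSeparable_iff [IsIntegral X₁] [IsDominant φ] (h : IsAlteration φ) :
    h.IsSeparable ↔ Algebra.IsSeparable X.functionField (FunctionFieldOver φ) := Iff.rfl

/-- The degree of an alteration is positive: `K(X₁)/K(X)` is a finite extension of fields
(de Jong 1996, 2.20: "the (finite) extension of function fields `R(S) ⊂ R(S')`").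
[cite: DeJong1996, 2.20, p. 61] -/
theorem degree_pos (h : IsAlteration φ) : 0 < h.degree := by
  haveI : IsIntegral X₁ := h.isIntegral
  haveI : IsDominant φ := h.isDominant
  haveI : FiniteDimensional X.functionField (FunctionFieldOver φ) :=
    h.finiteDimensional_functionFieldOver
  exact Module.finrank_pos

/-- The degree of an alteration is non-zero (de Jong 1996, 2.20: the extension of function fields
is finite). [cite: DeJong1996, 2.20, p. 61] -/
theorem degree_ne_zero (h : IsAlteration φ) : h.degree ≠ 0 := h.degree_pos.ne'

/-- Along the identity the structure map `K(X) → K(X)/K(X)` is bijective (`(𝟙 X)♯ = id`).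
[folklore] -/
private theorem bijective_algebraMap_functionFieldOver_id (X : Scheme.{u}) [IsIntegral X] :
    Function.Bijective (algebraMap X.functionField (FunctionFieldOver (𝟙 X))) := by
  have e : (algebraMap X.functionField (FunctionFieldOver (𝟙 X)) : _ → _) =
      fun s => FunctionFieldOver.of (𝟙 X) (functionFieldMap (𝟙 X) s) := by
    funext s
    exact FunctionFieldOver.algebraMap_apply (𝟙 X) s
  rw [e, functionFieldMap_id]
  exact (FunctionFieldOver.of (𝟙 X)).bijective

/-- Non-vacuity of the degree: the identity of an integral scheme (an alteration,
`isPurelyInseparableAlteration_id`) has degree `[K(X) : K(X)] = 1` (immediate from the definition,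
Temkin 2017, §1.1.2). [cite: Temkin2017, §1.1.2 (arXiv:1508.06255v2 p. 1)] -/
theorem degree_id (X : Scheme.{u}) [IsIntegral X] (h : IsAlteration (𝟙 X)) : h.degree = 1 := by
  rw [h.degree_eq_finrank]
  let e : X.functionField ≃ₐ[X.functionField] FunctionFieldOver (𝟙 X) :=
    AlgEquiv.ofBijective (Algebra.ofId _ _) (bijective_algebraMap_functionFieldOver_id X)
  rw [← e.toLinearEquiv.finrank_eq, Module.finrank_self]

/-- The identity alteration is separable: `K(X)/K(X)` is a separable algebra (immediate from the
definition, Exp. X 3.3.1). [cite: IllusieLaszloOrgogozo2014, Exp. X 3.3.1 (arXiv:1207.3648v1 p. 158)] -/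
theorem isSeparable_id (X : Scheme.{u}) [IsIntegral X] (h : IsAlteration (𝟙 X)) :
    h.IsSeparable := by
  rw [h.isSeparable_iff]
  let e : X.functionField ≃ₐ[X.functionField] FunctionFieldOver (𝟙 X) :=
    AlgEquiv.ofBijective (Algebra.ofId _ _) (bijective_algebraMap_functionFieldOver_id X)
  exact Algebra.IsSeparable.of_algHom X.functionField X.functionField e.symm.toAlgHom

end IsAlteration

/-! ## Gabber's prime-to-`ℓ` alteration theorem (named fact) -/

/-- NAMED FACT — **Gabber's prime-to-`ℓ` alteration theorem**, integral form over a field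
(Illusie–Laszlo–Orgogozo 2014, Exp. X, Thm. 2.1 (Gabber): "Let `k` be a field, `ℓ` a prime number
different from the characteristic of `k`, `X` a separated and finite type `k`-scheme, `Z ⊂ X` a
nowhere dense closed subset. Then there exists a finite extension `k'` of `k`, of degree prime to
`ℓ`, and a projective `ℓ'`-alteration `h : X̃ → X` above `Spec k' → Spec k`, with `X̃` smooth and
quasi-projective over `k'`, and `h⁻¹(Z)` is the support of a relative, strict normal crossings
divisor", an `ℓ'`-alteration being "proper, surjective, generically finite, maximally dominating and
the degrees of the residual extensions `k(x')/k(x)` over each maximal point `x` of `X` are prime to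
`ℓ`" (Exp. X §2); in Temkin's words (2017, §1.1.2): "if `ℓ` is a prime invertible on `X` then one can
achieve that the degree `[k(X') : k(X)]` of the alteration is not divisible by `ℓ`"). Rendering
(module docstring; weaker than print): for every field `k`, every prime `ℓ` with `(ℓ : k) ≠ 0`, every
integral separated `k`-scheme `X` of finite type and every closed `Z ≠ X` there are a REGULAR scheme
`X₁` and an alteration `φ : X₁ ⟶ X` (`IsAlteration`) with `ℓ ∤ [K(X₁) : K(X)]`
(`IsAlteration.degree`) such that `φ⁻¹(Z)` is a strict normal crossings divisor of `X₁`. Users take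
`(h : GabberPrimeToEllAlteration.{u})`.
[cite: IllusieLaszloOrgogozo2014, Exp. X Thm. 2.1 and §2 (arXiv:1207.3648v1 pp. 148–149); Exp. 0 Thm. 3 (1)]
[cite: Temkin2017, §1.1.2 (arXiv:1508.06255v2 p. 1)] -/
def GabberPrimeToEllAlteration : Prop :=
  ∀ (k : Type u) [Field k] (ℓ : ℕ), ℓ.Prime → (ℓ : k) ≠ 0 →
    ∀ (X : Scheme.{u}) [IsIntegral X] (f : X ⟶ Spec (.of k)),
      IsSeparated f → LocallyOfFiniteType f → QuasiCompact f →
      ∀ (Z : Set X), IsClosed Z → Z ≠ Set.univ →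
        ∃ (X₁ : Scheme.{u}) (φ : X₁ ⟶ X) (h : IsAlteration φ),
          Scheme.IsRegular X₁ ∧ ¬ ℓ ∣ h.degree ∧
            IsStrictNormalCrossingsDivisor X₁ (φ.base ⁻¹' Z)

/-! ## Temkin's `char(X)`-alteration theorem (named fact) -/

/-- NAMED FACT — **Temkin's desingularization by `char(X)`-alterations**, integral form over a
field (Temkin 2017, Thm. 1.2.5: "Let `X` be a scheme with a nowhere dense closed subset `Z` and
assume that `X` admits a morphism of finite type to a qe scheme `S` with `dim(S) ≤ 3`. Then there
exists a projective `char(X)`-alteration `b : X' → X` with a regular source such that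
`Z' = b⁻¹(Z)` is an snc divisor. Moreover, if `S = Spec(k)`, where `k` is a perfect field, then the
alteration `b` can be chosen separable", where (§1.2.1) "by `char(X)` we denote the set of all
primes `p` with `p = char(k(x))` for some `x ∈ X` […] `n ∈ ℕ` is a `𝒫`-number if all its prime
divisors lie in `𝒫`. By a `𝒫`-alteration we mean an alteration whose degree is a `𝒫`-number", and
(§1.2.4) "the general case is not essentially stronger than the case of integral `X` and `S`, in
which it suffices to consider alterations as defined earlier" (§1.1.1: "a proper dominant
generically finite morphism between integral schemes")). Rendering (module docstring; case
`S = Spec k`, `X` integral; weaker than print): for every field `k`, every integral separated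
`k`-scheme `X` of finite type and every closed `Z ≠ X` there are a REGULAR scheme `X₁` and an
alteration `φ : X₁ ⟶ X` such that every prime divisor `q` of `[K(X₁) : K(X)]` has `(q : k) = 0`
(all residue fields of `X` have characteristic `char k`, so this is "the degree is a
`char(X)`-number": a power of `p` in characteristic `p > 0`, degree `1` in characteristic `0`),
`φ⁻¹(Z)` is a strict normal crossings divisor of `X₁`, and, if `k` is perfect, `K(X₁)/K(X)` is
separable (`IsAlteration.IsSeparable`). Depends in print on Cossart–Piltant's resolution of
quasi-excellent threefolds only through `dim S = 0` here (Rem. 1.2.6 (i)). Users take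
`(h : Temkin2017PAlteration.{u})`.
[cite: Temkin2017, Thm. 1.2.5 with §§1.1.1, 1.2.1, 1.2.4, Rem. 1.2.6 (arXiv:1508.06255v2 pp. 1–3)] -/
def Temkin2017PAlteration : Prop :=
  ∀ (k : Type u) [Field k] (X : Scheme.{u}) [IsIntegral X] (f : X ⟶ Spec (.of k)),
    IsSeparated f → LocallyOfFiniteType f → QuasiCompact f →
    ∀ (Z : Set X), IsClosed Z → Z ≠ Set.univ →
      ∃ (X₁ : Scheme.{u}) (φ : X₁ ⟶ X) (h : IsAlteration φ),
        Scheme.IsRegular X₁ ∧ (∀ q : ℕ, q.Prime → q ∣ h.degree → (q : k) = 0) ∧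
          IsStrictNormalCrossingsDivisor X₁ (φ.base ⁻¹' Z) ∧ (PerfectField k → h.IsSeparable)

/-! ## Elementary consequences (bookkeeping; the degree statements in the usual currencies) -/

/-- In a non-trivial ring the primes `2` and `3` are not both zero, so every field has a prime
different from its characteristic. [folklore] -/
private theorem two_ne_zero_or_three_ne_zero (k : Type u) [Field k] : (2 : k) ≠ 0 ∨ (3 : k) ≠ 0 := by
  by_cases h2 : (2 : k) = 0
  · right
    intro h3
    have h1 : (1 : k) = 0 := by
      have e : (3 : k) - 2 = 1 := by norm_num
      rw [← e, h2, h3, sub_zero]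
    exact one_ne_zero h1
  · exact Or.inl h2

/-- The empty set is a proper closed subset of a non-empty (e.g. integral) scheme. [folklore] -/
private theorem empty_ne_univ_of_nonempty (X : Scheme.{u}) [Nonempty X] : (∅ : Set X) ≠ Set.univ := by
  intro h
  have hne : (Set.univ : Set X).Nonempty := Set.univ_nonempty
  rw [← h] at hne
  exact Set.not_nonempty_empty hne

/-- **Gabber ⟹ de Jong (weak form `DeJong1996`)**: take any prime `ℓ ∈ {2, 3}` non-zero in `k` and
`Z = ∅`, and forget the degree. [cite: IllusieLaszloOrgogozo2014, Exp. X Thm. 2.1]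
[cite: DeJong1996, Thm. 4.1] -/
theorem GabberPrimeToEllAlteration.deJong1996 (hG : GabberPrimeToEllAlteration.{u}) :
    DeJong1996.{u} := by
  intro k _ X f hs hl hq hi
  haveI := hi
  obtain ⟨ℓ, hℓ, hℓk⟩ : ∃ ℓ : ℕ, ℓ.Prime ∧ (ℓ : k) ≠ 0 := by
    rcases two_ne_zero_or_three_ne_zero k with h2 | h3
    · exact ⟨2, Nat.prime_two, by exact_mod_cast h2⟩
    · exact ⟨3, Nat.prime_three, by exact_mod_cast h3⟩
  obtain ⟨X₁, φ, hφ, hreg, -, -⟩ :=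
    hG k ℓ hℓ hℓk X f hs hl hq ∅ isClosed_empty (empty_ne_univ_of_nonempty X)
  exact ⟨X₁, φ, hφ, hreg⟩

/-- **Temkin ⟹ de Jong (weak form `DeJong1996`)**: take `Z = ∅` and forget the degree.
[cite: Temkin2017, Thm. 1.2.5] [cite: DeJong1996, Thm. 4.1] -/
theorem Temkin2017PAlteration.deJong1996 (hT : Temkin2017PAlteration.{u}) : DeJong1996.{u} := by
  intro k _ X f hs hl hq hi
  haveI := hi
  obtain ⟨X₁, φ, hφ, hreg, -, -, -⟩ :=
    hT k X f hs hl hq ∅ isClosed_empty (empty_ne_univ_of_nonempty X)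
  exact ⟨X₁, φ, hφ, hreg⟩

/-- **Temkin's theorem in characteristic `p`: the degree is a power of `p`.** For a field `k` of
prime characteristic `p`, the alteration of `Temkin2017PAlteration` has degree
`[K(X₁) : K(X)] = p ^ n` for some `n` (a "`p`-alteration" of the title).
[cite: Temkin2017, Thm. 1.2.5 and §1.2.1] -/
theorem Temkin2017PAlteration.exists_degree_eq_pow (hT : Temkin2017PAlteration.{u}) (k : Type u)
    [Field k] (p : ℕ) [hp : Fact p.Prime] [CharP k p] (X : Scheme.{u}) [IsIntegral X]
    (f : X ⟶ Spec (.of k)) [IsSeparated f] [LocallyOfFiniteType f] [QuasiCompact f] (Z : Set X)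
    (hZ : IsClosed Z) (hZ' : Z ≠ Set.univ) :
    ∃ (X₁ : Scheme.{u}) (φ : X₁ ⟶ X) (h : IsAlteration φ),
      Scheme.IsRegular X₁ ∧ (∃ n : ℕ, h.degree = p ^ n) ∧
        IsStrictNormalCrossingsDivisor X₁ (φ.base ⁻¹' Z) ∧ (PerfectField k → h.IsSeparable) := by
  obtain ⟨X₁, φ, hφ, hreg, hdeg, hsnc, hsep⟩ := hT k X f ‹_› ‹_› ‹_› Z hZ hZ'
  refine ⟨X₁, φ, hφ, hreg, ⟨hφ.degree.primeFactorsList.length, ?_⟩, hsnc, hsep⟩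
  refine Nat.eq_prime_pow_of_unique_prime_dvd hφ.degree_ne_zero ?_
  intro q hq hqd
  have hq0 : (q : k) = 0 := hdeg q hq hqd
  have hpq : p ∣ q := (CharP.cast_eq_zero_iff k p q).mp hq0
  exact ((Nat.prime_dvd_prime_iff_eq hp.out hq).mp hpq).symm

/-- **Temkin's theorem in characteristic `0`: the degree is `1`** ("this unifies almost all
previous results, including the characteristic zero case", §1.2.1: `char(X) = ∅`, so a
`char(X)`-alteration is a modification). [cite: Temkin2017, Thm. 1.2.5 and §1.2.1] -/
theorem Temkin2017PAlteration.exists_degree_eq_one (hT : Temkin2017PAlteration.{u}) (k : Type u)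
    [Field k] [CharZero k] (X : Scheme.{u}) [IsIntegral X] (f : X ⟶ Spec (.of k)) [IsSeparated f]
    [LocallyOfFiniteType f] [QuasiCompact f] (Z : Set X) (hZ : IsClosed Z) (hZ' : Z ≠ Set.univ) :
    ∃ (X₁ : Scheme.{u}) (φ : X₁ ⟶ X) (h : IsAlteration φ),
      Scheme.IsRegular X₁ ∧ h.degree = 1 ∧ IsStrictNormalCrossingsDivisor X₁ (φ.base ⁻¹' Z) := by
  obtain ⟨X₁, φ, hφ, hreg, hdeg, hsnc, -⟩ := hT k X f ‹_› ‹_› ‹_› Z hZ hZ'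
  refine ⟨X₁, φ, hφ, hreg, ?_, hsnc⟩
  refine Nat.eq_one_iff_not_exists_prime_dvd.mpr fun q hq hqd => ?_
  have hq0 : (q : k) = 0 := hdeg q hq hqd
  exact hq.ne_zero (by exact_mod_cast hq0)

/-- **Gabber's theorem in characteristic `p`: for every prime `ℓ ≠ p` a regular alteration of
degree prime to `ℓ`** (the hypothesis "`ℓ` different from the characteristic" discharged from
`CharP k p`). [cite: IllusieLaszloOrgogozo2014, Exp. X Thm. 2.1] -/
theorem GabberPrimeToEllAlteration.of_ne_char (hG : GabberPrimeToEllAlteration.{u}) (k : Type u)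
    [Field k] (p : ℕ) [CharP k p] (ℓ : ℕ) (hℓ : ℓ.Prime) (hℓp : ℓ ≠ p) (X : Scheme.{u})
    [IsIntegral X] (f : X ⟶ Spec (.of k)) [IsSeparated f] [LocallyOfFiniteType f] [QuasiCompact f]
    (Z : Set X) (hZ : IsClosed Z) (hZ' : Z ≠ Set.univ) :
    ∃ (X₁ : Scheme.{u}) (φ : X₁ ⟶ X) (h : IsAlteration φ),
      Scheme.IsRegular X₁ ∧ ¬ ℓ ∣ h.degree ∧ IsStrictNormalCrossingsDivisor X₁ (φ.base ⁻¹' Z) := by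
  have hℓk : (ℓ : k) ≠ 0 := by
    intro h0
    have hpl : p ∣ ℓ := (CharP.cast_eq_zero_iff k p ℓ).mp h0
    rcases CharP.char_is_prime_or_zero k p with hp | hp
    · exact hℓp ((Nat.prime_dvd_prime_iff_eq hp hℓ).mp hpl).symm
    · subst hp
      exact hℓ.ne_zero (Nat.eq_zero_of_zero_dvd hpl)
  exact hG k ℓ hℓ hℓk X f ‹_› ‹_› ‹_› Z hZ hZ'

/-- **Temkin ⟹ Gabber, between the TYPED forms: `Temkin2017PAlteration → GabberPrimeToEllAlteration`.**
Temkin 2017 presents Thm. 1.2.5 as a strengthening of Gabber's theorem: "We strengthen Gabber's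
`l'`-alteration theorem by avoiding all primes invertible on a scheme" (abstract, arXiv:1508.06255v2
p. 1) and "The main goal of this paper is to strengthen the `l'`-altered desingularization of morphisms
of [X] so that the resolving alteration `b : X' → X` is a `char(X)`-alteration. […] The only thing
which is lost is a control on the Galois properties of the alteration, for example, we do not achieve
that `b` is Galois" (§1.2.1, p. 2). For the renderings of this file that is literally an implication:
both named facts quantify over the same data (a field `k`, an integral separated `k`-scheme `X` of
finite type, a closed `Z ≠ X`) and conclude with the same regular source and the same strict normal
crossings clause, and a degree all of whose prime divisors `q` satisfy `(q : k) = 0` is divisible by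
no prime `ℓ` with `(ℓ : k) ≠ 0`. SCOPE: this is an implication between the TYPED statements only —
the printed Exp. X Thm. 2.1 also controls the extension `k'/k` (degree prime to `ℓ`), makes `X̃`
smooth quasi-projective over `k'` and the divisor RELATIVE snc, none of which the rendering
`GabberPrimeToEllAlteration` carries (module docstring: "weaker than print"), and Temkin's theorem
does not claim them. Bookkeeping consequence for users: a hypothesis
`(h : GabberPrimeToEllAlteration)` is discharged by `hT.gabber` from `(hT : Temkin2017PAlteration)`.
[cite: Temkin2017, abstract and §1.2.1 (arXiv:1508.06255v2 pp. 1–2); Thm. 1.2.5]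
[cite: IllusieLaszloOrgogozo2014, Exp. X Thm. 2.1 (arXiv:1207.3648v1 pp. 148–149)] -/
theorem Temkin2017PAlteration.gabber (hT : Temkin2017PAlteration.{u}) :
    GabberPrimeToEllAlteration.{u} := by
  intro k _ ℓ hℓ hℓk X hX f hs hl hq Z hZ hZ'
  haveI := hX
  obtain ⟨X₁, φ, hφ, hreg, hdeg, hsnc, -⟩ := hT k X f hs hl hq Z hZ hZ'
  exact ⟨X₁, φ, hφ, hreg, fun hd => hℓk (hdeg ℓ hℓ hd), hsnc⟩

/-- **… and in characteristic `p`, from Temkin's theorem alone: for every prime `ℓ ≠ p` a regular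
alteration of degree prime to `ℓ` with the strict normal crossings clause** (`GabberPrimeToEllAlteration.of_ne_char`
fed with `Temkin2017PAlteration.gabber`). [cite: Temkin2017, Thm. 1.2.5 and §1.2.1]
[cite: IllusieLaszloOrgogozo2014, Exp. X Thm. 2.1] -/
theorem Temkin2017PAlteration.exists_not_dvd_degree_of_ne_char (hT : Temkin2017PAlteration.{u})
    (k : Type u) [Field k] (p : ℕ) [CharP k p] (ℓ : ℕ) (hℓ : ℓ.Prime) (hℓp : ℓ ≠ p) (X : Scheme.{u})
    [IsIntegral X] (f : X ⟶ Spec (.of k)) [IsSeparated f] [LocallyOfFiniteType f] [QuasiCompact f]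
    (Z : Set X) (hZ : IsClosed Z) (hZ' : Z ≠ Set.univ) :
    ∃ (X₁ : Scheme.{u}) (φ : X₁ ⟶ X) (h : IsAlteration φ),
      Scheme.IsRegular X₁ ∧ ¬ ℓ ∣ h.degree ∧ IsStrictNormalCrossingsDivisor X₁ (φ.base ⁻¹' Z) :=
  GabberPrimeToEllAlteration.of_ne_char hT.gabber k p ℓ hℓ hℓp X f Z hZ hZ'

end Literature.AlgebraicGeometry.Resolution

end
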